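import Literature.NumberTheory.Transcendental.QuadraticRelationsLogarithmsResultant
import Mathlib.NumberTheory.MahlerMeasure
import Mathlib.Analysis.SpecialFunctions.Log.Basic
import HarnessLib

/-!
# Roy–Waldschmidt 1997, Proposition 3.6 and Corollaire 3.7 (integer polynomials)

Second brick of §3 of D. Roy, M. Waldschmidt, *Approximation diophantienne et indépendance
algébrique de logarithmes*, Ann. Sci. ÉNS (4) 30 (1997), towards the approximation theorem
(Théorème 3.2) used in the proof of their Théorème 1.1 (whose corollary Théorème 0.2 is the tree's
named fact `Literature.NumberTheory.Transcendental.royWaldschmidt_quadratic_thm_0_2`).  From the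
Wirsing-type estimate Lemme 3.4 (`RoyWaldschmidt1997.resultant_wirsing`,
file `QuadraticRelationsLogarithmsResultant.lean`) and the integrality of the resultant:

* `RoyWaldschmidt1997.prop_3_6` — **Proposition 3.6** (p. 767): for coprime `F, G ∈ ℤ[X]` and
  `θ ∈ ℂ`, with `s` the number of roots `α` of `F` (with multiplicity) with
  `|θ - α| < dist(θ, Z(G))`,
  `0 ≤ (log 2) deg F deg G + deg F log M(G) + deg G log M(F) + s log |G(θ)|`.
  (Printed with the extra hypothesis `dist(θ, Z(F)) ≤ dist(θ, Z(G))`, not needed for the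
  inequality; `dist(θ, Z(G))` enters only as a lower bound `d` for the distances from `θ` to the
  roots of `G`, any such `d` is allowed.)
* `RoyWaldschmidt1997.cor_3_7` — **Corollaire 3.7** (p. 767; "un résultat bien connu": Brownawell,
  Gel'fond, Tijdeman): for coprime non-zero `F, G ∈ ℤ[X]` and `θ ∈ ℂ`,
  `1 ≤ 2^{deg F deg G} M(F)^{deg G} M(G)^{deg F} max(|F(θ)|, |G(θ)|)`.

"Premiers entre eux" is rendered, as in the tree's `Polynomial.resultant_liouville`, by
`IsCoprime` of the images in `ℚ[X]`; `M` is the Mahler measure of the complexified polynomial.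
Everything is proved; no definitions, no named facts.

## References

* [RoyWaldschmidt1997ENS] D. Roy, M. Waldschmidt, Ann. Sci. ÉNS (4) 30 (1997) 753–796, §3 (ii)
  Proposition 3.6 and Corollaire 3.7, p. 767 (lit key paper:doi-10-1016-s0012-9593-97-89938-7,
  PDF p. 16).
-/

noncomputable section

open Polynomial Multiset

namespace Literature.NumberTheory.Transcendental

namespace RoyWaldschmidt1997

/-- The resultant of coprime integer polynomials has complex absolute value `≥ 1` (it is a
non-zero integer). [folklore] -/
theorem one_le_norm_resultant_map (F G : ℤ[X])
    (hcop : IsCoprime (F.map (Int.castRingHom ℚ)) (G.map (Int.castRingHom ℚ))) :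
    1 ≤ ‖resultant (F.map (Int.castRingHom ℂ)) (G.map (Int.castRingHom ℂ))‖ := by
  set m := F.natDegree with hm
  set n := G.natDegree with hn
  have hmC : (F.map (Int.castRingHom ℂ)).natDegree = m :=
    natDegree_map_eq_of_injective (RingHom.injective_int _) _
  have hnC : (G.map (Int.castRingHom ℂ)).natDegree = n :=
    natDegree_map_eq_of_injective (RingHom.injective_int _) _
  have hR0 : resultant F G m n ≠ 0 := by
    intro h0
    have hq : resultant (F.map (Int.castRingHom ℚ)) (G.map (Int.castRingHom ℚ)) m n = 0 := by
      rw [resultant_map_map, h0]; simp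
    have hm' : (F.map (Int.castRingHom ℚ)).natDegree = m :=
      natDegree_map_eq_of_injective (RingHom.injective_int _) _
    have hn' : (G.map (Int.castRingHom ℚ)).natDegree = n :=
      natDegree_map_eq_of_injective (RingHom.injective_int _) _
    have := resultant_ne_zero _ _ hcop
    rw [hm', hn'] at this
    exact this hq
  have e : resultant (F.map (Int.castRingHom ℂ)) (G.map (Int.castRingHom ℂ)) =
      ((resultant F G m n : ℤ) : ℂ) := by
    rw [show resultant (F.map (Int.castRingHom ℂ)) (G.map (Int.castRingHom ℂ)) =
        resultant (F.map (Int.castRingHom ℂ)) (G.map (Int.castRingHom ℂ)) m n by rw [← hmC, ← hnC],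
      resultant_map_map, eq_intCast]
  rw [e, Complex.norm_intCast]
  exact_mod_cast Int.one_le_abs hR0

/-- **Roy–Waldschmidt 1997, Proposition 3.6.**  Let `F, G ∈ ℤ[X]` be non-zero and coprime,
`θ ∈ ℂ`, and `d` a lower bound for the distances from `θ` to the roots of `G` (e.g.
`d = dist(θ, Z(G))`); let `s` be the number of roots `α` of `F`, with multiplicity, with
`|θ - α| < d`.  Then `0 ≤ (log 2) deg F deg G + deg F log M(G) + deg G log M(F) + s log |G(θ)|`.
Proof: Lemme 3.4 with the close roots `A = {α ; |θ - α| < d}` of `F` and none of `G`, and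
`|Res(F,G)| ≥ 1`. [cite: RoyWaldschmidt1997ENS, §3 (ii) Proposition 3.6, p. 767] -/
theorem prop_3_6 (F G : ℤ[X]) (hF : F ≠ 0) (hG : G ≠ 0)
    (hcop : IsCoprime (F.map (Int.castRingHom ℚ)) (G.map (Int.castRingHom ℚ))) (θ : ℂ) (d : ℝ)
    (hd : ∀ β ∈ (G.map (Int.castRingHom ℂ)).roots, d ≤ ‖θ - β‖) :
    0 ≤ Real.log 2 * F.natDegree * G.natDegree +
      F.natDegree * Real.log (G.map (Int.castRingHom ℂ)).mahlerMeasure +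
      G.natDegree * Real.log (F.map (Int.castRingHom ℂ)).mahlerMeasure +
      card ((F.map (Int.castRingHom ℂ)).roots.filter fun α => ‖θ - α‖ < d) *
        Real.log ‖aeval θ G‖ := by
  classical
  set Fc := F.map (Int.castRingHom ℂ) with hFc
  set Gc := G.map (Int.castRingHom ℂ) with hGc
  have hFc0 : Fc ≠ 0 := (Polynomial.map_ne_zero_iff (RingHom.injective_int _)).mpr hF
  have hGc0 : Gc ≠ 0 := (Polynomial.map_ne_zero_iff (RingHom.injective_int _)).mpr hG
  have hmC : Fc.natDegree = F.natDegree := natDegree_map_eq_of_injective (RingHom.injective_int _) _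
  have hnC : Gc.natDegree = G.natDegree := natDegree_map_eq_of_injective (RingHom.injective_int _) _
  set A := Fc.roots.filter fun α => ‖θ - α‖ < d with hA
  set s := card A with hs
  have hMF : 1 ≤ Fc.mahlerMeasure := one_le_mahlerMeasure_of_ne_zero hF
  have hMG : 1 ≤ Gc.mahlerMeasure := one_le_mahlerMeasure_of_ne_zero hG
  -- Lemme 3.4 with `A`, `B = ∅`, `ρ = 0`
  have h34 := resultant_wirsing Fc Gc hFc0 hGc0 θ A 0 (Multiset.filter_le _ _) (Multiset.zero_le _) 0
    le_rfl (fun _ _ => norm_nonneg _) (fun _ _ => norm_nonneg _)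
    (fun α hα β hβ => by
      rw [tsub_zero] at hβ
      exact ((Multiset.mem_filter.mp hα).2.trans_le (hd β hβ)).le)
    (fun β hβ => absurd hβ (Multiset.notMem_zero β))
  simp only [card_zero, mul_zero, pow_zero, one_mul, tsub_zero, mul_one] at h34
  -- `1 ≤ |Res|`
  have hres := one_le_norm_resultant_map F G hcop
  have hsm : s ≤ Fc.natDegree := by
    rw [hs, hA, ← card_roots_eq Fc]; exact Multiset.card_le_card (Multiset.filter_le _ _)
  have hGθ : ‖Gc.eval θ‖ = ‖aeval θ G‖ := by rw [hGc, eval_map, ← algebraMap_int_eq, ← aeval_def]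
  -- the product bound `1 ≤ 2^{mn} M(F)^n M(G)^{m-s} |G(θ)|^s ≤ 2^{mn} M(F)^n M(G)^m |G(θ)|^s`
  have h1 : 1 ≤ 2 ^ (Fc.natDegree * Gc.natDegree) * Fc.mahlerMeasure ^ Gc.natDegree *
      Gc.mahlerMeasure ^ Fc.natDegree * ‖aeval θ G‖ ^ s := by
    calc (1 : ℝ) ≤ ‖resultant Fc Gc‖ := hres
      _ ≤ 2 ^ (Fc.natDegree * Gc.natDegree) * Fc.mahlerMeasure ^ Gc.natDegree *
          Gc.mahlerMeasure ^ (Fc.natDegree - s) * ‖Gc.eval θ‖ ^ s := h34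
      _ ≤ 2 ^ (Fc.natDegree * Gc.natDegree) * Fc.mahlerMeasure ^ Gc.natDegree *
          Gc.mahlerMeasure ^ Fc.natDegree * ‖Gc.eval θ‖ ^ s :=
          mul_le_mul_of_nonneg_right
            (mul_le_mul_of_nonneg_left (pow_le_pow_right₀ hMG (Nat.sub_le _ _)) (by positivity))
            (by positivity)
      _ = _ := by rw [hGθ]
  -- take logarithms
  by_cases hG0 : ‖aeval θ G‖ = 0
  · -- then `s = 0` is forced by `h1` unless `s = 0`; in any case `log 0 = 0`
    rw [hG0, Real.log_zero, mul_zero, add_zero]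
    have h2 : 0 ≤ Real.log 2 := Real.log_nonneg (by norm_num)
    have h3 : 0 ≤ Real.log Gc.mahlerMeasure := Real.log_nonneg hMG
    have h4 : 0 ≤ Real.log Fc.mahlerMeasure := Real.log_nonneg hMF
    positivity
  have hGpos : 0 < ‖aeval θ G‖ := lt_of_le_of_ne (norm_nonneg _) (Ne.symm hG0)
  have hlog := Real.log_le_log one_pos h1
  rw [Real.log_one, Real.log_mul (by positivity) (by positivity), Real.log_mul (by positivity) (by positivity),
    Real.log_mul (by positivity) (by positivity), Real.log_pow, Real.log_pow, Real.log_pow,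
    Real.log_pow, hmC, hnC, Nat.cast_mul] at hlog
  linarith

/-- **Roy–Waldschmidt 1997, Corollaire 3.7** ("un résultat bien connu", cf. Brownawell 1974,
Gel'fond, Tijdeman): for non-zero coprime `F, G ∈ ℤ[X]` and `θ ∈ ℂ`,
`1 ≤ 2^{deg F deg G} M(F)^{deg G} M(G)^{deg F} max(|F(θ)|, |G(θ)|)`.
Proof: Lemme 3.4 with the single closest root (of `F` or of `G`) as the only close root, and
`|Res(F,G)| ≥ 1`. [cite: RoyWaldschmidt1997ENS, §3 (ii) Corollaire 3.7, p. 767] -/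
theorem cor_3_7 (F G : ℤ[X]) (hF : F ≠ 0) (hG : G ≠ 0)
    (hcop : IsCoprime (F.map (Int.castRingHom ℚ)) (G.map (Int.castRingHom ℚ))) (θ : ℂ) :
    1 ≤ 2 ^ (F.natDegree * G.natDegree) *
      (F.map (Int.castRingHom ℂ)).mahlerMeasure ^ G.natDegree *
      (G.map (Int.castRingHom ℂ)).mahlerMeasure ^ F.natDegree *
      max ‖aeval θ F‖ ‖aeval θ G‖ := by
  classical
  set Fc := F.map (Int.castRingHom ℂ) with hFc
  set Gc := G.map (Int.castRingHom ℂ) with hGc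
  have hFc0 : Fc ≠ 0 := (Polynomial.map_ne_zero_iff (RingHom.injective_int _)).mpr hF
  have hGc0 : Gc ≠ 0 := (Polynomial.map_ne_zero_iff (RingHom.injective_int _)).mpr hG
  have hmC : Fc.natDegree = F.natDegree := natDegree_map_eq_of_injective (RingHom.injective_int _) _
  have hnC : Gc.natDegree = G.natDegree := natDegree_map_eq_of_injective (RingHom.injective_int _) _
  have hMF : 1 ≤ Fc.mahlerMeasure := one_le_mahlerMeasure_of_ne_zero hF
  have hMG : 1 ≤ Gc.mahlerMeasure := one_le_mahlerMeasure_of_ne_zero hG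
  have hres := one_le_norm_resultant_map F G hcop
  have hFθ : ‖Fc.eval θ‖ = ‖aeval θ F‖ := by rw [hFc, eval_map, ← algebraMap_int_eq, ← aeval_def]
  have hGθ : ‖Gc.eval θ‖ = ‖aeval θ G‖ := by rw [hGc, eval_map, ← algebraMap_int_eq, ← aeval_def]
  rw [← hmC, ← hnC]
  -- a closest root among all roots of `F` and `G`, if any
  by_cases hroots : (Fc.roots + Gc.roots) = 0
  · -- no roots: `F`, `G` constant; Lemme 3.4 with no close roots gives `1 ≤ 2^{mn} M(F)^n M(G)^m`
    have hm0 : Fc.natDegree = 0 := by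
      rw [← card_roots_eq Fc]; have := congrArg card hroots; rw [card_add, card_zero] at this; omega
    have hn0 : Gc.natDegree = 0 := by
      rw [← card_roots_eq Gc]; have := congrArg card hroots; rw [card_add, card_zero] at this; omega
    -- `F = C c` with `|c| ≥ 1`
    have hFconst : ‖aeval θ F‖ = Fc.mahlerMeasure := by
      rw [← hFθ, eq_C_of_natDegree_eq_zero hm0, eval_C, mahlerMeasure_const]
    rw [hm0, hn0]
    simp only [mul_zero, pow_zero, one_mul, mul_one]
    exact hMF.trans (hFconst ▸ le_max_left _ _)
  · obtain ⟨γ, hγmem, hγmin⟩ := Finset.exists_min_image (Fc.roots + Gc.roots).toFinset (fun z => ‖θ - z‖)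
      (by
        obtain ⟨z, hz⟩ := Multiset.exists_mem_of_ne_zero hroots
        exact ⟨z, Multiset.mem_toFinset.mpr hz⟩)
    rw [Multiset.mem_toFinset, Multiset.mem_add] at hγmem
    have hmin : ∀ z ∈ Fc.roots + Gc.roots, ‖θ - γ‖ ≤ ‖θ - z‖ := fun z hz =>
      hγmin z (Multiset.mem_toFinset.mpr hz)
    rcases hγmem with hγF | hγG
    · -- closest root is a root of `F`: close roots `A = {γ}`, `B = ∅`
      have h34 := resultant_wirsing Fc Gc hFc0 hGc0 θ {γ} 0 (Multiset.singleton_le.mpr hγF)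
        (Multiset.zero_le _) 0 le_rfl (fun _ _ => norm_nonneg _) (fun _ _ => norm_nonneg _)
        (fun α hα β hβ => by
          rw [Multiset.mem_singleton.mp hα]; rw [tsub_zero] at hβ
          exact hmin β (Multiset.mem_add.mpr (Or.inr hβ)))
        (fun β hβ => absurd hβ (Multiset.notMem_zero β))
      simp only [card_singleton, card_zero, mul_zero, pow_zero, one_mul, tsub_zero, pow_one,
        mul_one] at h34
      have hm1 : 1 ≤ Fc.natDegree := by
        rw [← card_roots_eq Fc]
        exact Multiset.card_pos.mpr (by rintro h; rw [h] at hγF; exact Multiset.notMem_zero _ hγF)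
      calc (1 : ℝ) ≤ ‖resultant Fc Gc‖ := hres
        _ ≤ 2 ^ (Fc.natDegree * Gc.natDegree) * Fc.mahlerMeasure ^ Gc.natDegree *
            Gc.mahlerMeasure ^ (Fc.natDegree - 1) * ‖Gc.eval θ‖ := h34
        _ ≤ 2 ^ (Fc.natDegree * Gc.natDegree) * Fc.mahlerMeasure ^ Gc.natDegree *
            Gc.mahlerMeasure ^ Fc.natDegree * max ‖aeval θ F‖ ‖aeval θ G‖ := by
            rw [hGθ]
            exact mul_le_mul (mul_le_mul_of_nonneg_left (pow_le_pow_right₀ hMG (Nat.sub_le _ _))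
              (by positivity)) (le_max_right _ _) (norm_nonneg _) (by positivity)
    · -- closest root is a root of `G`: `A = ∅`, `B = {γ}`
      have h34 := resultant_wirsing Fc Gc hFc0 hGc0 θ 0 {γ} (Multiset.zero_le _)
        (Multiset.singleton_le.mpr hγG) 0 le_rfl (fun _ _ => norm_nonneg _) (fun _ _ => norm_nonneg _)
        (fun α hα => absurd hα (Multiset.notMem_zero α))
        (fun β hβ α hα => by
          rw [Multiset.mem_singleton.mp hβ]; rw [tsub_zero] at hα
          exact hmin α (Multiset.mem_add.mpr (Or.inl hα)))
      simp only [card_singleton, card_zero, pow_zero, one_mul, tsub_zero, pow_one,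
        mul_one] at h34
      calc (1 : ℝ) ≤ ‖resultant Fc Gc‖ := hres
        _ ≤ 2 ^ (Fc.natDegree * Gc.natDegree) * Fc.mahlerMeasure ^ (Gc.natDegree - 1) *
            Gc.mahlerMeasure ^ Fc.natDegree * ‖Fc.eval θ‖ := h34
        _ ≤ 2 ^ (Fc.natDegree * Gc.natDegree) * Fc.mahlerMeasure ^ Gc.natDegree *
            Gc.mahlerMeasure ^ Fc.natDegree * max ‖aeval θ F‖ ‖aeval θ G‖ := by
            rw [hFθ]
            exact mul_le_mul (mul_le_mul_of_nonneg_right (mul_le_mul_of_nonneg_left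
              (pow_le_pow_right₀ hMF (Nat.sub_le _ _)) (by positivity)) (by positivity))
              (le_max_left _ _) (norm_nonneg _) (by positivity)

end RoyWaldschmidt1997

end Literature.NumberTheory.Transcendental
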